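import Literature.Computability.AlgebraicComplexity.GenericDegreeMonoidCofinite
import Literature.Computability.AlgebraicComplexity.BI17MinimalDegreeTableExtension
import Literature.Computability.AlgebraicComplexity.BI17Rem54OfBLMW11Prop81
import HarnessLib

/-!
# When is the generic degree monoid `E(m)` co-finite in `mℕ`? — a criterion and the small formats
# (theorem-only)

Bürgisser–Ikenmeyer 2017 §5 [BurgisserIkenmeyer2017]: `E(m) = {0} ∪ {mδ : k_m(δ) > 0}`
(`genericTensorDegreeMonoid_eq_kronRect`); Ex. 5.6 lists `E(m) = {0} ∪ (e(m) + mℕ)` (no gaps at all)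
for `m ≤ 12`, and `E(2) = 4ℕ` (Rem. 5.4: `k_2(δ) = [δ even]`, BLMW 2011 Prop. 8.1, tree theorem
`BLMW2011_prop_8_1_holds`). With the Latin-rectangle bridge the tree knows `k_m(δ) > 0` for EVERY
`m ≥ 1` and every EVEN `δ ≥ 2m²` (`kronRect_pos_of_two_mul_sq_le`), whence:

* `kronRect_eventually_pos_iff` — **CRITERION: for `m ≥ 1`, `k_m(δ) > 0` for all large `δ` (i.e.
  `E(m)` is co-finite in `mℕ`) iff `k_m(δ₀) > 0` for SOME odd `δ₀`** (then `k_m(δ) > 0` for every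
  `δ ≥ 2m² + δ₀`, `kronRect_pos_of_odd_witness`); odd `m` always qualify (`δ₀ = m`,
  `GenericDegreeMonoidCofinite.lean`);
* `kronRect_two_not_eventually_pos` — **`m = 2` does NOT** (`E'(2) = 2ℕ`);
* `kronRect_eventually_pos_even_small` — the even formats `m = 4, 6, 8, 10, 18, 20, 22, 24` and
  `40, 42, 44, 46, 48` DO (odd witnesses `k_4(3), k_6(3), k_8(3), k_10(5)`, `k_m(5) = k_{25−m}(5)`,
  `k_m(7) = k_{49−m}(7)` from the tree); for `m = 12, 14, 16` an odd witness is exactly one of the open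
  odd-`δ` atoms of `BI2017_ex_5_6` (`k_12(5)`/`k_12(7)`, `k_14(5) = k_11(5)`, `k_16(5) = k_9(5)`) or a
  larger unknown value — OPEN in the tree (in print, Ex. 5.6 gives `5 ∈ E'(12)`).

Honest framing (cell `val-lit`, row BI2017-B): structure of BI's degree monoids from the tree's own
theorems; no named fact moves; VP ≠ VNP is NOT proved. No definitions, no named facts.

## References

* [BurgisserIkenmeyer2017] P. Bürgisser, C. Ikenmeyer, J. Algebra 477 (2017), §5: eq. (5.2), Rem. 5.4,
  Ex. 5.6, Rem. 5.18, Problem 5.19.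
* [BurgisserLandsbergManivelWeyman2011] BLMW, SIAM J. Comput. 40 (2011), Prop. 8.1 (`k_2(δ)`).
-/

noncomputable section

namespace Literature.Computability.AlgebraicComplexity

variable {m δ δ₀ : ℕ}

/-- **An odd witness propagates**: if `k_m(δ₀) > 0` for an odd `δ₀` then `k_m(δ) > 0` for every
`δ ≥ 2m² + δ₀` (even `δ`: the Latin-rectangle family; odd `δ = (δ − δ₀) + δ₀` by the semigroup
property). [cite: BurgisserIkenmeyer2017, §5 eq. (5.2) and Rem. 5.18] -/
theorem kronRect_pos_of_odd_witness (hm : 0 < m) (hδ₀ : Odd δ₀) (h₀ : 0 < kronRect ℂ m δ₀)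
    (h : 2 * m ^ 2 + δ₀ ≤ δ) : 0 < kronRect ℂ m δ := by
  rcases Nat.even_or_odd δ with he | ho
  · exact kronRect_pos_of_two_mul_sq_le ℂ (by omega) he
  · have he : Even (δ - δ₀) := Nat.Odd.sub_odd ho hδ₀
    have h1 : 0 < kronRect ℂ m (δ - δ₀) := kronRect_pos_of_two_mul_sq_le ℂ (by omega) he
    have h2 := kronRect_add_pos hm h1 h₀
    rwa [Nat.sub_add_cancel (by omega : δ₀ ≤ δ)] at h2

/-- **Co-finiteness criterion for `E(m)`** (`m ≥ 1`): `k_m(δ) > 0` for all sufficiently large `δ`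
iff `k_m(δ₀) > 0` for some odd `δ₀`. [cite: BurgisserIkenmeyer2017, §5 eq. (5.2) and Problem 5.19] -/
theorem kronRect_eventually_pos_iff (hm : 0 < m) :
    (∃ N : ℕ, ∀ δ : ℕ, N ≤ δ → 0 < kronRect ℂ m δ) ↔ ∃ δ₀ : ℕ, Odd δ₀ ∧ 0 < kronRect ℂ m δ₀ := by
  constructor
  · rintro ⟨N, hN⟩
    exact ⟨2 * N + 1, odd_two_mul_add_one N, hN _ (by omega)⟩
  · rintro ⟨δ₀, hδ₀, h₀⟩
    exact ⟨2 * m ^ 2 + δ₀, fun δ hδ => kronRect_pos_of_odd_witness hm hδ₀ h₀ hδ⟩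

/-- The monoid form: `E(m) ⊇ m·[N, ∞)` for some `N` iff `E(m)` contains an odd multiple `mδ₀` of `m`
with `k_m(δ₀) > 0`. [cite: BurgisserIkenmeyer2017, §5 eq. (5.2)] -/
theorem genericTensorDegreeMonoid_cofinite_iff (hm : 0 < m) :
    (∃ N : ℕ, ∀ δ : ℕ, N ≤ δ → m * δ ∈ genericTensorDegreeMonoid (Fin m) ℂ) ↔
      ∃ δ₀ : ℕ, Odd δ₀ ∧ 0 < kronRect ℂ m δ₀ := by
  rw [← kronRect_eventually_pos_iff hm, genericTensorDegreeMonoid_eq_kronRect m]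
  refine ⟨fun ⟨N, hN⟩ => ⟨N, fun δ hδ => ?_⟩, fun ⟨N, hN⟩ => ⟨N, fun δ hδ => ⟨δ, rfl, hN δ hδ⟩⟩⟩
  obtain ⟨δ', hδ', hpos⟩ := hN δ hδ
  rw [Nat.eq_of_mul_eq_mul_left hm hδ']
  exact hpos

/-- **Odd formats qualify** (witness `δ₀ = m`, square positivity).
[cite: BurgisserIkenmeyer2017, §5 eq. (5.2) and Rem. 5.18] -/
theorem kronRect_eventually_pos_of_odd (hm : Odd m) :
    ∃ N : ℕ, ∀ δ : ℕ, N ≤ δ → 0 < kronRect ℂ m δ :=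
  (kronRect_eventually_pos_iff hm.pos).2 ⟨m, hm, kronRect_self_pos m hm.pos⟩

/-- **`m = 2` does not qualify: `E'(2) = 2ℕ`** (`k_2(δ) = [δ even]`, BI Rem. 5.4 / BLMW Prop. 8.1).
[cite: BurgisserIkenmeyer2017, Rem. 5.4] -/
theorem kronRect_two_not_eventually_pos : ¬ ∃ N : ℕ, ∀ δ : ℕ, N ≤ δ → 0 < kronRect ℂ 2 δ := by
  rw [kronRect_eventually_pos_iff (by norm_num)]
  rintro ⟨δ₀, hδ₀, h₀⟩
  rw [kronRect_two_of_BLMW2011_prop_8_1 BLMW2011_prop_8_1_holds δ₀,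
    if_neg (Nat.not_even_iff_odd.2 hδ₀)] at h₀
  exact lt_irrefl 0 h₀

/-- **The small even formats with an odd witness in the tree**: `E(m)` is co-finite in `mℕ` for
`m = 4, 6, 8, 10` (`k_4(3), k_6(3), k_8(3), k_10(5) > 0`), `m = 18, 20, 22, 24` (`k_m(5) = k_{25−m}(5)`:
`k_7(5), k_5(5), k_3(5), k_1(5)`) and `m = 40, 42, 44, 46, 48` (`k_m(7) = k_{49−m}(7)`: `k_9(7), k_7(7),
k_5(7), k_3(7), k_1(7)`). (`m = 12, 14, 16`: an odd witness would be `k_12(5)`/`k_12(7)`,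
`k_14(5) = k_11(5)`, `k_16(5) = k_9(5)` — open atoms of `BI2017_ex_5_6` — or a larger unknown value.)
[cite: BurgisserIkenmeyer2017, Ex. 5.6 and Problem 5.19] -/
theorem kronRect_eventually_pos_even_small (hm : m ∈ ({4, 6, 8, 10, 18, 20, 22, 24, 40, 42, 44, 46, 48} : Finset ℕ)) :
    ∃ N : ℕ, ∀ δ : ℕ, N ≤ δ → 0 < kronRect ℂ m δ := by
  simp only [Finset.mem_insert, Finset.mem_singleton] at hm
  rcases hm with rfl | rfl | rfl | rfl | rfl | rfl | rfl | rfl | rfl | rfl | rfl | rfl | rfl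
  · exact (kronRect_eventually_pos_iff (by norm_num)).2 ⟨3, by decide, kronRect_four_three_pos⟩
  · exact (kronRect_eventually_pos_iff (by norm_num)).2 ⟨3, by decide, kronRect_six_three_pos⟩
  · exact (kronRect_eventually_pos_iff (by norm_num)).2 ⟨3, by decide, kronRect_eight_three_pos⟩
  · exact (kronRect_eventually_pos_iff (by norm_num)).2 ⟨5, by decide, kronRect_ten_five_pos⟩
  · exact (kronRect_eventually_pos_iff (by norm_num)).2 ⟨5, by decide, kronRect_eighteen_five_pos⟩
  · exact (kronRect_eventually_pos_iff (by norm_num)).2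
      ⟨5, by decide, kronRect_sq_sub_pos (δ := 5) (j := 5) (by norm_num) kronRect_five_five_pos⟩
  · exact (kronRect_eventually_pos_iff (by norm_num)).2
      ⟨5, by decide, kronRect_sq_sub_pos (δ := 5) (j := 3) (by norm_num) (kronRect_three_pos (by norm_num))⟩
  · exact (kronRect_eventually_pos_iff (by norm_num)).2
      ⟨5, by decide, kronRect_sq_sub_pos (δ := 5) (j := 1) (by norm_num) (kronRect_one_pos 5)⟩
  · exact (kronRect_eventually_pos_iff (by norm_num)).2
      ⟨7, by decide, kronRect_sq_sub_pos (δ := 7) (j := 9) (by norm_num)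
        (kronRect_nine_pos_of_six_le (by norm_num))⟩
  · exact (kronRect_eventually_pos_iff (by norm_num)).2
      ⟨7, by decide, kronRect_sq_sub_pos (δ := 7) (j := 7) (by norm_num) (kronRect_self_pos 7 (by norm_num))⟩
  · exact (kronRect_eventually_pos_iff (by norm_num)).2
      ⟨7, by decide, kronRect_sq_sub_pos (δ := 7) (j := 5) (by norm_num)
        (kronRect_five_pos_of_three_le (by norm_num))⟩
  · exact (kronRect_eventually_pos_iff (by norm_num)).2
      ⟨7, by decide, kronRect_sq_sub_pos (δ := 7) (j := 3) (by norm_num) (kronRect_three_pos (by norm_num))⟩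
  · exact (kronRect_eventually_pos_iff (by norm_num)).2
      ⟨7, by decide, kronRect_sq_sub_pos (δ := 7) (j := 1) (by norm_num) (kronRect_one_pos 7)⟩

end Literature.Computability.AlgebraicComplexity

end
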